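import Summits.QuantumFields.YangMills.Theorems.BalabanUVNodesN15CovariantLandauGradRowLeibniz
import Summits.QuantumFields.YangMills.Theorems.BalabanUVNodesN15CovariantAveragingTwoGrid
import Summits.QuantumFields.YangMills.Theorems.BalabanUVNodesN15BackwardShift
import HarnessLib

/-!
# Route «BalabanUVNodes», node N15 = NE2, road (c) — PROGRAMME (P-S), XXVII: THE TWO-GRID CALCULUS OF THE LOCAL OPERATORS OF THE LANDAU LETTER
# (exact intertwining of the multipliers `𝔇_W`, `𝔰_V`, `ℭ_W`, `ℭ_Wᵀ` with King's pull-backs up to the OSCILLATION letter; the shifted multiplier `𝔇_WS` up to `n⁻¹·𝔇·P̂·∂`; block rows)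
# (dag-n15-c g24, n15-c∕235; HOME HANDOFF g23 «LOCATED NEXT (g24): (G3) the two-grid η-defect row of N_V^R»)

Cell `pub-ymgap`, seat `pub-ymgap-dag-n15-c` (generation g24; R134 (a), s1; HUMAN RULING D-0062; chair R424 venue).  `bears_on: R4∕N15 · K3⁸ SpineGivenEndpointR13SepCoPHV
(stmt-QuantumFields-27366)`; filed `--supports stmt-QuantumFields-27366 --as helper` — COUNT-NEUTRAL.  Theorems only; 0 `sorry`.  Imports BY NAME n15-c∕224–229 (`bShift`, `bDiag`,
`bContr`, `sDiag`, `bMulShift` and their pointwise actions; `hasMaj_sDiag_if`, `hasMaj_bContr_transpose_if`, `hasMaj_bContr_if`), n15-c∕184a (`blockOf_kingPr`), n15-c∕M-series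
(`kingPr_add_unitVec`), dag-n15-a's product-carrier kit (`liftMap`, `liftBlk`, `mmulOp`, `idef_mmulOp_eq`, `loc_fine_mmul_pull_le`), the T⁴ cell's `idef`∕`pull`∕`hasMaj_pull`.
Nothing in the tree is modified.

WHY (the g24 object).  After n15-c∕234 the ONE displayed row of the (P-S) chain is the two-grid η-defect of the Landau letter, `idef P̂ P̂ (N_V^R)′ (N_V^R)` between the spacings
`η = L^{−k}` (`n = L^k` points per unit-block side) and `η′ = L^{−m}η` (`n′ = L^mL^k`), `P̂ = pull ∘ liftMap (kingPr ∕ kingPrV)` King's pairing.  The programme reduces it to FLAT two-grid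
kernel rows by Leibniz over words (kernel)·(local)·(propagator); THIS FILE is the two-grid calculus of the LOCAL letters: a site∕bond multiplier intertwines with the pull-backs EXACTLY up to
the multiplier of the OSCILLATION `W′ − W∘pr` (no derivative of a pulled-back field is ever taken), and the shifted multiplier `𝔇_WS` (n15-c∕225's `bMulShift`, `B = ∂ − D_T = 𝔇_{n(1−T)}S`) up to
`−n⁻¹·𝔇_{W′χ}·P̂·∂` (`χ` = the fine bonds NOT leaving their `L^m`-cell: `pr(x′ + e′_ν) = pr x′` there, `= pr x′ + e_ν` on the upper face — `kingPr_add_unitVec`), whose cost downstream is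
ONE gradient row of the operand scaled by `n⁻¹` — never a second derivative, never a derivative of a pulled-back field.
* §1 `mulVecLin_sDiag ∕ bDiag` (dictionary to `mmulOp`); §2 `liftBlk_blockOf_comp_kingPr(V)` + variants (fine unit blocks = coarse unit blocks of the paired point), the pull-back rows
  `hasMaj_pull_kingPr(V)_lift`; §3 ★ EXACT INTERTWINING `idef_sDiag`, `idef_bDiag`, `idef_bContr`, `idef_bContr_transpose`, ★★ `idef_bMulShift`;
* §4 ROWS: ★ `hasMaj_of_mmul_pull` (one estimate for every «multiplier ∘ pull-back»), `hasMaj_sDiag_pull`, `hasMaj_bDiag_pull`, `hasMaj_bContr_transpose_pull`, `hasMaj_bContr_pull`,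
  ★★ `hasMaj_idef_bMulShift_comp` (the defect of `𝔇_WS` on an operand `𝒪`: `ω·(row of S𝒪) + n⁻¹w′·(row of ∂𝒪)`).

HONEST FRAMING ∕ LIMITS.  Finite-dimensional bookkeeping (exact identities + sup-block rows); MODEL carriers; no propagator estimate here; NOT [Balaban1985BackgroundPropagators] Lemma 3.3 ∕
Thm 3.4 as printed; NE2⁺ NOT PRINTED; N15 of record untouched (DISCHARGED AS CONSUMED, p687738); counts UNMOVED (typed 28∕28 · discharged 8∕27); one finite 𝕋⁴ at fixed ε per index — NOT
infinite volume ∕ OS ∕ mass gap ∕ Clay.  Restate-immune (no Theses import).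
-/

noncomputable section

open scoped BigOperators Matrix
open Finset

namespace Summit.QuantumFields.YangMills.BalabanUVNodes.N15.CovLandau

open Literature.MathematicalPhysics.QuantumFieldTheory.Balaban1983to89
open Literature.MathematicalPhysics.QuantumFieldTheory.Balaban1983to89.B5Prop11Plancherel (Tor fine unitVec)
open Literature.MathematicalPhysics.QuantumFieldTheory.Balaban1983to89.B11SectG (BlockNorm HasMaj)
open Literature.MathematicalPhysics.QuantumFieldTheory.Balaban1983to89.B6UnitTorusCarrier (unitTorusGeo)
open Literature.MathematicalPhysics.QuantumFieldTheory.Balaban1983to89.T4EtaRateDefect (idef idef_apply idef_comp)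
open Literature.MathematicalPhysics.QuantumFieldTheory.Balaban1983to89.T4EtaRateCoeffDefect (pull pull_apply diagK hasMaj_pull)
open Literature.MathematicalPhysics.QuantumFieldTheory.King1986.Torus (blockOf tdistT)
open Summit.QuantumFields.YangMills.BalabanUVNodes.N15.MatrixSpecies (liftBlk liftMap mmulOp mmulOp_apply idef_mmulOp_eq loc_fine_mmul_pull_le)
open Summit.QuantumFields.YangMills.BalabanUVNodes.N15.VectorPiece (kingPr kingPrV kingPrV_eq kingPr_add_unitVec)
open Summit.QuantumFields.YangMills.BalabanUVNodes.N15.CovAvg (blockOf_kingPr rows_one)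
open Summit.QuantumFields.YangMills.BalabanUVNodes.N15.BackgroundModel (kappa_ofBlocks)
open Summit.QuantumFields.YangMills.BalabanUVNodes.N15.TwoGrid (hasMaj_smul_ofBlocks)
open Summit.QuantumFields.YangMills.BalabanUVNodes.N15.BlockRows (hasMaj_comp_localRight hasMaj_comp_localLeft)

variable {d : ℕ}

/-! ## §1 Dictionary: the local operators of n15-c∕224–225 as product-carrier multiplication operators -/

section Dictionary

variable (M : Fin (d + 1) → ℕ) [∀ μ, NeZero (M μ)] (n : ℕ) [NeZero n] {ι : Type} [Fintype ι]

/-- `𝔰_V = M_V` (dag-n15-a's `mmulOp` on the scalar product carrier). [folklore] -/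
theorem mulVecLin_sDiag (V : Tor (fine n M) → Matrix ι ι ℝ) : Matrix.mulVecLin (sDiag M n V) = mmulOp V := by
  refine LinearMap.ext fun f => funext fun q => ?_
  obtain ⟨z, i⟩ := q
  simp only [Matrix.mulVecLin_apply, sDiag_mulVec, mmulOp_apply]

/-- `𝔇_W = M_{(b ↦ W_{b.2}(b.1))}` (dag-n15-a's `mmulOp` on the bond product carrier). [folklore] -/
theorem mulVecLin_bDiag (W : Fin (d + 1) → Tor (fine n M) → Matrix ι ι ℝ) :
    Matrix.mulVecLin (bDiag M n W) = mmulOp (fun b : Tor (fine n M) × Fin (d + 1) => W b.2 b.1) := by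
  refine LinearMap.ext fun ω => funext fun p => ?_
  obtain ⟨b, i⟩ := p
  simp only [Matrix.mulVecLin_apply, bDiag_mulVec, mmulOp_apply]

end Dictionary

/-! ## §2 King's pairing: fine unit blocks are the coarse unit blocks of the paired point; the pull-backs are block contractions -/

section Pairing

variable (M : Fin (d + 1) → ℕ) [∀ μ, NeZero (M μ)] (ι : Type) (L k m : ℕ) [NeZero L]

/-- Scalars: `blockOf n ∘ pr = blockOf n′` on the product carrier (composition form). [cite: King1986, p.664 (pairing convention «x′ ∈ B^n(x)»)] -/
theorem liftBlk_blockOf_comp_kingPr :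
    (liftBlk (blockOf (L ^ k) M) ι ∘ liftMap (kingPr L k m M) ι) = liftBlk (blockOf (L ^ m * L ^ k) M) ι := by
  funext p
  simp only [Function.comp_apply, liftBlk]
  exact blockOf_kingPr M L k m p.1

/-- Scalars: the same with the composition inside. [cite: King1986, p.664 (pairing convention)] -/
theorem liftBlk_blockOf_kingPr : liftBlk (blockOf (L ^ k) M ∘ kingPr L k m M) ι = liftBlk (blockOf (L ^ m * L ^ k) M) ι :=
  funext fun p => blockOf_kingPr M L k m p.1

/-- Bonds: `blockOf n ∘ pr = blockOf n′` on the bond product carrier (composition form). [cite: King1986, p.664 (pairing convention)] -/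
theorem liftBlk_blockOf_comp_kingPrV :
    (liftBlk (fun b : Tor (fine (L ^ k) M) × Fin (d + 1) => blockOf (L ^ k) M b.1) ι ∘ liftMap (kingPrV L k m M) ι) =
      liftBlk (fun b : Tor (fine (L ^ m * L ^ k) M) × Fin (d + 1) => blockOf (L ^ m * L ^ k) M b.1) ι := by
  funext p
  simp only [Function.comp_apply, liftBlk, kingPrV_eq]
  exact blockOf_kingPr M L k m p.1.1

/-- Bonds: the same with the composition inside. [cite: King1986, p.664 (pairing convention)] -/
theorem liftBlk_blockOfV_kingPrV :
    liftBlk ((fun b : Tor (fine (L ^ k) M) × Fin (d + 1) => blockOf (L ^ k) M b.1) ∘ kingPrV L k m M) ι = liftBlk (fun b : Tor (fine (L ^ m * L ^ k) M) × Fin (d + 1) => blockOf (L ^ m * L ^ k) M b.1) ι :=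
  funext fun p => blockOf_kingPr M L k m p.1.1

/-- Site-to-bond shape: `blockOf n ∘ (pr ∘ base point) = blockOf n′ ∘ base point`. [cite: King1986, p.664 (pairing convention)] -/
theorem liftBlk_blockOf_kingPr_fst :
    liftBlk (blockOf (L ^ k) M ∘ fun b : Tor (fine (L ^ m * L ^ k) M) × Fin (d + 1) => kingPr L k m M b.1) ι = liftBlk (fun b : Tor (fine (L ^ m * L ^ k) M) × Fin (d + 1) => blockOf (L ^ m * L ^ k) M b.1) ι :=
  funext fun p => blockOf_kingPr M L k m p.1.1

variable {ι} [Fintype ι]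

/-- The scalar pull-back `P̂_S = pull ∘ liftMap pr` is a block contraction: majorant `𝟙[y = y′]`. [folklore] -/
theorem hasMaj_pull_kingPr_lift :
    HasMaj (BlockNorm.ofBlocks (unitTorusGeo L k M) (liftBlk (blockOf (L ^ k) M) ι)) (BlockNorm.ofBlocks (unitTorusGeo L k M) (liftBlk (blockOf (L ^ m * L ^ k) M) ι))
      (pull (liftMap (kingPr L k m M) ι)) (fun y y' => if y = y' then (1 : ℝ) else 0) := by
  have h := hasMaj_pull (g := unitTorusGeo L k M) (liftBlk (blockOf (L ^ k) M) ι) (liftMap (kingPr L k m M) ι)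
  rw [liftBlk_blockOf_comp_kingPr] at h
  exact h.mono fun y y' => le_of_eq (by simp only [diagK])

/-- The bond pull-back `P̂_V` is a block contraction: majorant `𝟙[y = y′]`. [folklore] -/
theorem hasMaj_pull_kingPrV_lift :
    HasMaj (BlockNorm.ofBlocks (unitTorusGeo L k M) (liftBlk (fun b : Tor (fine (L ^ k) M) × Fin (d + 1) => blockOf (L ^ k) M b.1) ι))
      (BlockNorm.ofBlocks (unitTorusGeo L k M) (liftBlk (fun b : Tor (fine (L ^ m * L ^ k) M) × Fin (d + 1) => blockOf (L ^ m * L ^ k) M b.1) ι))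
      (pull (liftMap (kingPrV L k m M) ι)) (fun y y' => if y = y' then (1 : ℝ) else 0) := by
  have h := hasMaj_pull (g := unitTorusGeo L k M) (liftBlk (fun b : Tor (fine (L ^ k) M) × Fin (d + 1) => blockOf (L ^ k) M b.1) ι) (liftMap (kingPrV L k m M) ι)
  rw [liftBlk_blockOf_comp_kingPrV] at h
  exact h.mono fun y y' => le_of_eq (by simp only [diagK])

end Pairing

/-! ## §3 Exact intertwining of the local operators with the pull-backs -/

section Intertwining

variable (M : Fin (d + 1) → ℕ) [∀ μ, NeZero (M μ)] {ι : Type} [Fintype ι] (L k m : ℕ) [NeZero L]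

/-- ★ `𝔰_{V′}P̂ − P̂𝔰_V = 𝔰_{V′ − V∘pr}P̂` — a site multiplier meets the pull-back only through its oscillation over King's cells. [folklore] -/
theorem idef_sDiag [DecidableEq ι] (V' : Tor (fine (L ^ m * L ^ k) M) → Matrix ι ι ℝ) (V : Tor (fine (L ^ k) M) → Matrix ι ι ℝ) :
    idef (pull (liftMap (kingPr L k m M) ι)) (pull (liftMap (kingPr L k m M) ι)) (Matrix.mulVecLin (sDiag M (L ^ m * L ^ k) V')) (Matrix.mulVecLin (sDiag M (L ^ k) V)) =
      Matrix.mulVecLin (sDiag M (L ^ m * L ^ k) (fun x' => V' x' - V (kingPr L k m M x'))) ∘ₗ pull (liftMap (kingPr L k m M) ι) := by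
  rw [mulVecLin_sDiag, mulVecLin_sDiag, mulVecLin_sDiag]
  exact idef_mmulOp_eq (kingPr L k m M) V' V

/-- ★ `𝔇_{W′}P̂ − P̂𝔇_W = 𝔇_{W′ − W∘pr}P̂` (bond multipliers). [folklore] -/
theorem idef_bDiag (W' : Fin (d + 1) → Tor (fine (L ^ m * L ^ k) M) → Matrix ι ι ℝ) (W : Fin (d + 1) → Tor (fine (L ^ k) M) → Matrix ι ι ℝ) :
    idef (pull (liftMap (kingPrV L k m M) ι)) (pull (liftMap (kingPrV L k m M) ι)) (Matrix.mulVecLin (bDiag M (L ^ m * L ^ k) W')) (Matrix.mulVecLin (bDiag M (L ^ k) W)) =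
      Matrix.mulVecLin (bDiag M (L ^ m * L ^ k) (fun ν x' => W' ν x' - W ν (kingPr L k m M x'))) ∘ₗ pull (liftMap (kingPrV L k m M) ι) := by
  refine LinearMap.ext fun ω => funext fun p => ?_
  obtain ⟨⟨x', ν⟩, i⟩ := p
  simp only [idef_apply, LinearMap.comp_apply, Matrix.mulVecLin_apply, Pi.sub_apply, bDiag_mulVec, pull_apply, liftMap, kingPrV_eq, Matrix.sub_apply, sub_mul,
    Finset.sum_sub_distrib]

/-- ★ `ℭ_{W′}P̂_V − P̂_Sℭ_W = ℭ_{W′ − W∘pr}P̂_V` (the contraction: bond fields to site fields, same site — no shift). [folklore] -/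
theorem idef_bContr (W' : Fin (d + 1) → Tor (fine (L ^ m * L ^ k) M) → Matrix ι ι ℝ) (W : Fin (d + 1) → Tor (fine (L ^ k) M) → Matrix ι ι ℝ) :
    idef (pull (liftMap (kingPrV L k m M) ι)) (pull (liftMap (kingPr L k m M) ι)) (Matrix.mulVecLin (bContr M (L ^ m * L ^ k) W')) (Matrix.mulVecLin (bContr M (L ^ k) W)) =
      Matrix.mulVecLin (bContr M (L ^ m * L ^ k) (fun ν x' => W' ν x' - W ν (kingPr L k m M x'))) ∘ₗ pull (liftMap (kingPrV L k m M) ι) := by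
  refine LinearMap.ext fun ω => funext fun q => ?_
  obtain ⟨z, i⟩ := q
  simp only [idef_apply, LinearMap.comp_apply, Matrix.mulVecLin_apply, Pi.sub_apply, bContr_mulVec, pull_apply, liftMap, kingPrV_eq, Matrix.sub_apply, sub_mul,
    Finset.sum_sub_distrib]

/-- ★ `ℭ_{W′}ᵀP̂_S − P̂_Vℭ_Wᵀ = ℭ_{W′ − W∘pr}ᵀP̂_S` (site fields to bond fields, same site). [folklore] -/
theorem idef_bContr_transpose (W' : Fin (d + 1) → Tor (fine (L ^ m * L ^ k) M) → Matrix ι ι ℝ) (W : Fin (d + 1) → Tor (fine (L ^ k) M) → Matrix ι ι ℝ) :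
    idef (pull (liftMap (kingPr L k m M) ι)) (pull (liftMap (kingPrV L k m M) ι)) (Matrix.mulVecLin (bContr M (L ^ m * L ^ k) W')ᵀ) (Matrix.mulVecLin (bContr M (L ^ k) W)ᵀ) =
      Matrix.mulVecLin (bContr M (L ^ m * L ^ k) (fun ν x' => W' ν x' - W ν (kingPr L k m M x')))ᵀ ∘ₗ pull (liftMap (kingPr L k m M) ι) := by
  refine LinearMap.ext fun f => funext fun p => ?_
  obtain ⟨⟨z, μ⟩, i⟩ := p
  simp only [idef_apply, LinearMap.comp_apply, Matrix.mulVecLin_apply, Pi.sub_apply, bContr_transpose_mulVec, pull_apply, liftMap, kingPrV_eq, Matrix.sub_apply, sub_mul,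
    Finset.sum_sub_distrib]

/-- ★★ **THE SHIFTED MULTIPLIER MEETS THE PULL-BACK UP TO `n⁻¹·𝔇·P̂·∂`**: `𝔇_{W′}S′P̂_S − P̂_V𝔇_WS = 𝔇_{W′−W∘pr}P̂_VS − n⁻¹·𝔇_{W′χ}P̂_V∂` where `(W′χ)_ν(x′) = 𝟙[L^m ∤ x′_ν + 1]·W′_ν(x′)` keeps the fine bonds
staying inside their `L^m`-cell (`pr(x′ + e′_ν) = pr x′` there; on the upper face `pr(x′ + e′_ν) = pr x′ + e_ν` and the shifts agree).  The price of a shift is ONE coarse gradient `∂ = D_1` of the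
operand, scaled by `n⁻¹`. [cite: King1986, p.664 (pairing convention «x′ ∈ B^n(x)»)] -/
theorem idef_bMulShift [DecidableEq ι] (W' : Fin (d + 1) → Tor (fine (L ^ m * L ^ k) M) → Matrix ι ι ℝ) (W : Fin (d + 1) → Tor (fine (L ^ k) M) → Matrix ι ι ℝ) :
    idef (pull (liftMap (kingPr L k m M) ι)) (pull (liftMap (kingPrV L k m M) ι)) (Matrix.mulVecLin (bMulShift M (L ^ m * L ^ k) W')) (Matrix.mulVecLin (bMulShift M (L ^ k) W)) =
      (Matrix.mulVecLin (bDiag M (L ^ m * L ^ k) (fun ν x' => W' ν x' - W ν (kingPr L k m M x'))) ∘ₗ pull (liftMap (kingPrV L k m M) ι)) ∘ₗ Matrix.mulVecLin (bShift M (L ^ k))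
        - (((L ^ k : ℕ) : ℝ))⁻¹ • ((Matrix.mulVecLin (bDiag M (L ^ m * L ^ k) (fun ν x' => if L ^ m ∣ (x' ν).val + 1 then (0 : Matrix ι ι ℝ) else W' ν x')) ∘ₗ pull (liftMap (kingPrV L k m M) ι)) ∘ₗ
            Matrix.mulVecLin (cgrad M (L ^ k) (fun (_ : Fin (d + 1)) (_ : Tor (fine (L ^ k) M)) => (1 : Matrix ι ι ℝ)))) := by
  refine LinearMap.ext fun f => funext fun p => ?_
  obtain ⟨⟨x', ν⟩, i⟩ := p
  have hn : (((L ^ k : ℕ) : ℝ)) ≠ 0 := Nat.cast_ne_zero.mpr (pow_ne_zero _ (NeZero.ne L))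
  have hc : ∀ a b : ℝ, (((L ^ k : ℕ) : ℝ))⁻¹ * (a * ((((L ^ k : ℕ) : ℝ)) * b)) = a * b := fun a b => by field_simp
  simp only [idef_apply, LinearMap.sub_apply, LinearMap.comp_apply, LinearMap.smul_apply, Matrix.mulVecLin_apply, Pi.sub_apply, Pi.smul_apply, smul_eq_mul, bMulShift_mulVec,
    bDiag_mulVec, bShift_mulVec, pull_apply, liftMap, kingPrV_eq, cgrad_mulVec, Matrix.one_apply, ite_mul, one_mul, zero_mul, Finset.sum_ite_eq, Finset.mem_univ, if_true,
    Matrix.sub_apply, sub_mul, Finset.sum_sub_distrib]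
  rw [kingPr_add_unitVec M L k m x' ν]
  by_cases hdvd : L ^ m ∣ (x' ν).val + 1
  · simp only [if_pos hdvd, Matrix.zero_apply, zero_mul, Finset.sum_const_zero, mul_zero, sub_zero]
  · simp only [if_neg hdvd, Finset.mul_sum, hc, mul_sub, Finset.sum_sub_distrib]
    ring

end Intertwining

/-! ## §4 Rows -/

section Rows

variable {X X' : Type} [Fintype X] [Fintype X'] {ι : Type} [Fintype ι] {g : B6.Geometry}

/-- ★ **ONE ESTIMATE FOR EVERY «MULTIPLIER ∘ PULL-BACK»**: a linear map acting as `(Tf)(p) = Σ_j c(p.1)_{p.2 j}·f(π p.1, j)` with row letter `Σ_j|c(x′)_{ij}| ≤ o(blk(πx′))` has the diagonal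
majorant `𝟙[y = y′]·o(y′)` from the coarse product blocks `blk` to the fine ones `blk ∘ π`. [folklore] -/
theorem hasMaj_of_mmul_pull (blk : X → g.Site) (π : X' → X) {c : X' → Matrix ι ι ℝ} {o : g.Site → ℝ} {T : (X × ι → ℝ) →ₗ[ℝ] (X' × ι → ℝ)}
    (hT : ∀ f p, T f p = ∑ j, c p.1 p.2 j * f (π p.1, j)) (ho : ∀ y, 0 ≤ o y) (hc : ∀ x' i, ∑ j, |c x' i j| ≤ o (blk (π x'))) :
    HasMaj (BlockNorm.ofBlocks g (liftBlk blk ι)) (BlockNorm.ofBlocks g (liftBlk (blk ∘ π) ι)) T (diagK o) := by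
  intro y' μ hμ y
  have hfun : T μ = fun p => ∑ j, c p.1 p.2 j * μ (π p.1, j) := funext fun p => hT μ p
  rw [hfun]
  exact loc_fine_mmul_pull_le blk π ho hc hμ y

end Rows

section LocalRows

variable (M : Fin (d + 1) → ℕ) [∀ μ, NeZero (M μ)] {ι : Type} [Fintype ι] (L k m : ℕ) [NeZero L]

/-- `𝔰_ΩP̂_S ≤ 𝟙[y = y′]·ω` for the row letter `ω` of `Ω` (coarse scalars to fine scalars). [folklore] -/
theorem hasMaj_sDiag_pull [DecidableEq ι] (Ω : Tor (fine (L ^ m * L ^ k) M) → Matrix ι ι ℝ) {ω : ℝ} (hω0 : 0 ≤ ω) (hω : ∀ x' i, ∑ j, |Ω x' i j| ≤ ω) :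
    HasMaj (BlockNorm.ofBlocks (unitTorusGeo L k M) (liftBlk (blockOf (L ^ k) M) ι)) (BlockNorm.ofBlocks (unitTorusGeo L k M) (liftBlk (blockOf (L ^ m * L ^ k) M) ι))
      (Matrix.mulVecLin (sDiag M (L ^ m * L ^ k) Ω) ∘ₗ pull (liftMap (kingPr L k m M) ι)) (fun y y' => if y = y' then ω else 0) := by
  have h := hasMaj_of_mmul_pull (g := unitTorusGeo L k M) (blockOf (L ^ k) M) (kingPr L k m M) (c := Ω) (o := fun _ => ω)
    (T := Matrix.mulVecLin (sDiag M (L ^ m * L ^ k) Ω) ∘ₗ pull (liftMap (kingPr L k m M) ι))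
    (fun f p => by obtain ⟨z, i⟩ := p; simp only [LinearMap.comp_apply, Matrix.mulVecLin_apply, sDiag_mulVec, pull_apply, liftMap]) (fun _ => hω0) (fun x' i => hω x' i)
  rw [liftBlk_blockOf_kingPr] at h
  exact h.mono fun y y' => le_of_eq (by simp only [diagK])

/-- `𝔇_ΩP̂_V ≤ 𝟙[y = y′]·ω` for the row letter `ω` of `Ω` (coarse bonds to fine bonds). [folklore] -/
theorem hasMaj_bDiag_pull (Ω : Fin (d + 1) → Tor (fine (L ^ m * L ^ k) M) → Matrix ι ι ℝ) {ω : ℝ} (hω0 : 0 ≤ ω) (hω : ∀ ν x' i, ∑ j, |Ω ν x' i j| ≤ ω) :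
    HasMaj (BlockNorm.ofBlocks (unitTorusGeo L k M) (liftBlk (fun b : Tor (fine (L ^ k) M) × Fin (d + 1) => blockOf (L ^ k) M b.1) ι))
      (BlockNorm.ofBlocks (unitTorusGeo L k M) (liftBlk (fun b : Tor (fine (L ^ m * L ^ k) M) × Fin (d + 1) => blockOf (L ^ m * L ^ k) M b.1) ι))
      (Matrix.mulVecLin (bDiag M (L ^ m * L ^ k) Ω) ∘ₗ pull (liftMap (kingPrV L k m M) ι)) (fun y y' => if y = y' then ω else 0) := by
  have h := hasMaj_of_mmul_pull (g := unitTorusGeo L k M) (fun b : Tor (fine (L ^ k) M) × Fin (d + 1) => blockOf (L ^ k) M b.1) (kingPrV L k m M) (c := fun b' => Ω b'.2 b'.1) (o := fun _ => ω)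
    (T := Matrix.mulVecLin (bDiag M (L ^ m * L ^ k) Ω) ∘ₗ pull (liftMap (kingPrV L k m M) ι))
    (fun f p => by obtain ⟨⟨x', ν⟩, i⟩ := p; simp only [LinearMap.comp_apply, Matrix.mulVecLin_apply, bDiag_mulVec, pull_apply, liftMap]) (fun _ => hω0) (fun b' i => hω b'.2 b'.1 i)
  rw [liftBlk_blockOfV_kingPrV] at h
  exact h.mono fun y y' => le_of_eq (by simp only [diagK])

/-- `ℭ_Ωᵀ P̂_S ≤ 𝟙[y = y′]·ω′` for the COLUMN letter `ω′` of `Ω` (coarse scalars to fine bonds). [folklore] -/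
theorem hasMaj_bContr_transpose_pull (Ω : Fin (d + 1) → Tor (fine (L ^ m * L ^ k) M) → Matrix ι ι ℝ) {ω : ℝ} (hω0 : 0 ≤ ω) (hω : ∀ μ x' i, ∑ j, |Ω μ x' j i| ≤ ω) :
    HasMaj (BlockNorm.ofBlocks (unitTorusGeo L k M) (liftBlk (blockOf (L ^ k) M) ι))
      (BlockNorm.ofBlocks (unitTorusGeo L k M) (liftBlk (fun b : Tor (fine (L ^ m * L ^ k) M) × Fin (d + 1) => blockOf (L ^ m * L ^ k) M b.1) ι))
      (Matrix.mulVecLin (bContr M (L ^ m * L ^ k) Ω)ᵀ ∘ₗ pull (liftMap (kingPr L k m M) ι)) (fun y y' => if y = y' then ω else 0) := by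
  have h := hasMaj_of_mmul_pull (g := unitTorusGeo L k M) (blockOf (L ^ k) M) (fun b' : Tor (fine (L ^ m * L ^ k) M) × Fin (d + 1) => kingPr L k m M b'.1)
    (c := fun b' => (Ω b'.2 b'.1)ᵀ) (o := fun _ => ω) (T := Matrix.mulVecLin (bContr M (L ^ m * L ^ k) Ω)ᵀ ∘ₗ pull (liftMap (kingPr L k m M) ι))
    (fun f p => by obtain ⟨⟨z, μ⟩, i⟩ := p; simp only [LinearMap.comp_apply, Matrix.mulVecLin_apply, bContr_transpose_mulVec, pull_apply, liftMap, Matrix.transpose_apply]) (fun _ => hω0)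
    (fun b' i => by simpa only [Matrix.transpose_apply] using hω b'.2 b'.1 i)
  rw [liftBlk_blockOf_kingPr_fst] at h
  exact h.mono fun y y' => le_of_eq (by simp only [diagK])

/-- `ℭ_Ω P̂_V ≤ 𝟙[y = y′]·(d+1)ω` for the row letter `ω` of `Ω` (coarse bonds to fine scalars). [folklore] -/
theorem hasMaj_bContr_pull [DecidableEq ι] (Ω : Fin (d + 1) → Tor (fine (L ^ m * L ^ k) M) → Matrix ι ι ℝ) {ω : ℝ} (hω0 : 0 ≤ ω) (hω : ∀ μ x' i, ∑ j, |Ω μ x' i j| ≤ ω) :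
    HasMaj (BlockNorm.ofBlocks (unitTorusGeo L k M) (liftBlk (fun b : Tor (fine (L ^ k) M) × Fin (d + 1) => blockOf (L ^ k) M b.1) ι))
      (BlockNorm.ofBlocks (unitTorusGeo L k M) (liftBlk (blockOf (L ^ m * L ^ k) M) ι))
      (Matrix.mulVecLin (bContr M (L ^ m * L ^ k) Ω) ∘ₗ pull (liftMap (kingPrV L k m M) ι)) (fun y y' => if y = y' then ((d : ℝ) + 1) * ω else 0) := by
  have h := hasMaj_comp_localRight (hasMaj_bContr_if M (L ^ m * L ^ k) L k Ω hω0 hω) (hasMaj_pull_kingPrV_lift M L k m (ι := ι)) (fun y y' => by positivity)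
  refine h.mono fun y y' => le_of_eq ?_
  rw [kappa_ofBlocks]
  split_ifs <;> ring

variable {F₁ : Type} [AddCommGroup F₁] [Module ℝ F₁]

/-- ★★ **THE DEFECT OF THE SHIFTED MULTIPLIER ON AN OPERAND** (`idef_bMulShift` estimated): for any operand `𝒪` into coarse scalars with rows of `S𝒪` (`K_S`) and of its flat coarse gradient `∂𝒪`
(`K_D`), `(𝔇_{W′}S′P̂_S − P̂_V𝔇_WS)∘𝒪 ≤ ω·K_S + n⁻¹·w′·K_D` (`ω` = row letter of the oscillation `W′ − W∘pr`, `w′` = row letter of `W′`). [folklore] -/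
theorem hasMaj_idef_bMulShift_comp [DecidableEq ι] {b₁ : BlockNorm (unitTorusGeo L k M) F₁} (W' : Fin (d + 1) → Tor (fine (L ^ m * L ^ k) M) → Matrix ι ι ℝ)
    (W : Fin (d + 1) → Tor (fine (L ^ k) M) → Matrix ι ι ℝ) {𝒪 : F₁ →ₗ[ℝ] (Tor (fine (L ^ k) M) × ι → ℝ)} {ω w' : ℝ} {KS KD : Tor M → Tor M → ℝ}
    (hω0 : 0 ≤ ω) (hw0 : 0 ≤ w') (hKD : ∀ y y', 0 ≤ KD y y')
    (hω : ∀ ν x' i, ∑ j, |(W' ν x' - W ν (kingPr L k m M x')) i j| ≤ ω) (hw : ∀ ν x' i, ∑ j, |W' ν x' i j| ≤ w')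
    (hS : HasMaj b₁ (BlockNorm.ofBlocks (unitTorusGeo L k M) (liftBlk (fun b : Tor (fine (L ^ k) M) × Fin (d + 1) => blockOf (L ^ k) M b.1) ι)) (Matrix.mulVecLin (bShift M (L ^ k)) ∘ₗ 𝒪) KS)
    (hD : HasMaj b₁ (BlockNorm.ofBlocks (unitTorusGeo L k M) (liftBlk (fun b : Tor (fine (L ^ k) M) × Fin (d + 1) => blockOf (L ^ k) M b.1) ι))
      (Matrix.mulVecLin (cgrad M (L ^ k) (fun (_ : Fin (d + 1)) (_ : Tor (fine (L ^ k) M)) => (1 : Matrix ι ι ℝ))) ∘ₗ 𝒪) KD) :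
    HasMaj b₁ (BlockNorm.ofBlocks (unitTorusGeo L k M) (liftBlk (fun b : Tor (fine (L ^ m * L ^ k) M) × Fin (d + 1) => blockOf (L ^ m * L ^ k) M b.1) ι))
      (idef (pull (liftMap (kingPr L k m M) ι)) (pull (liftMap (kingPrV L k m M) ι)) (Matrix.mulVecLin (bMulShift M (L ^ m * L ^ k) W')) (Matrix.mulVecLin (bMulShift M (L ^ k) W)) ∘ₗ 𝒪)
      (fun y y' => ω * KS y y' + (((L ^ k : ℕ) : ℝ))⁻¹ * w' * KD y y') := by
  have hκ : (BlockNorm.ofBlocks (unitTorusGeo L k M) (liftBlk (fun b : Tor (fine (L ^ k) M) × Fin (d + 1) => blockOf (L ^ k) M b.1) ι)).κ = 1 := kappa_ofBlocks _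
  have hosc := hasMaj_bDiag_pull M L k m (fun ν x' => W' ν x' - W ν (kingPr L k m M x')) hω0 hω
  have hχ : ∀ ν x' i, ∑ j, |(fun ν x' => if L ^ m ∣ (x' ν).val + 1 then (0 : Matrix ι ι ℝ) else W' ν x') ν x' i j| ≤ w' := by
    intro ν x' i
    by_cases hdvd : L ^ m ∣ (x' ν).val + 1
    · simp only [if_pos hdvd, Matrix.zero_apply, abs_zero, Finset.sum_const_zero]; exact hw0
    · simp only [if_neg hdvd]; exact hw ν x' i
  have hcut := hasMaj_bDiag_pull M L k m (fun ν x' => if L ^ m ∣ (x' ν).val + 1 then (0 : Matrix ι ι ℝ) else W' ν x') hw0 hχ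
  have h1 := hasMaj_comp_localLeft hω0 hosc hS
  have h2 := hasMaj_smul_ofBlocks (g := unitTorusGeo L k M) (liftBlk (fun b : Tor (fine (L ^ m * L ^ k) M) × Fin (d + 1) => blockOf (L ^ m * L ^ k) M b.1) ι)
    (K := fun y y' => w' * ((BlockNorm.ofBlocks (unitTorusGeo L k M) (liftBlk (fun b : Tor (fine (L ^ k) M) × Fin (d + 1) => blockOf (L ^ k) M b.1) ι)).κ * KD y y'))
    (fun y y' => mul_nonneg hw0 (mul_nonneg (BlockNorm.κ_nonneg _) (hKD y y'))) ((((L ^ k : ℕ) : ℝ))⁻¹) (hasMaj_comp_localLeft hw0 hcut hD)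
  rw [idef_bMulShift, LinearMap.sub_comp, LinearMap.smul_comp, LinearMap.comp_assoc, LinearMap.comp_assoc]
  refine (h1.sub h2).mono fun y y' => le_of_eq ?_
  rw [hκ, abs_of_nonneg (by positivity : (0 : ℝ) ≤ (((L ^ k : ℕ) : ℝ))⁻¹)]
  ring

end LocalRows

end Summit.QuantumFields.YangMills.BalabanUVNodes.N15.CovLandau

end
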